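import Summits.BirchSwinnertonDyer.BirchSwinnertonDyer.Theorems.SchneiderFreeAdditiveX3OrdinaryLineCharacter
import Summits.BirchSwinnertonDyer.BirchSwinnertonDyer.Theorems.SchneiderFreeAdditiveX3LocalTowerTorsionFiniteOfUnitRoot
import HarnessLib

/-!
# The F-record `AnticycControlAdditiveKFF` (stmt-BirchSwinnertonDyer-19669) CLOSED by name
# (route `SchneiderFreeAdditiveX3`, seat `bsd-schneider-door-c6` gen 3)

`AnticycControlAdditiveKFF := (∀ K p, ZpExtension.exists_isFrobPow_mem_kerSubgroup_of_isAnticyclotomic K p)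
→ AnticycControlAdditiveKF` (the anticyclotomic control EQUALITY of the K1 door's control corner —
#Sel = #(Λ/f)_Γ · torsion atoms, under PT ×2 / Brink ×2 / Kolyvagin carried inside `…KF` — with the
ONE cite-only LCFT fact as antecedent): door-c5 g6's glue `anticycControlAdditiveKFF_of_unitRoot`
(p457466: Fin_v record ∘ door-c4 g3's `anticycControlAdditiveKF_of_finV_of_regimeB2` p442095 ∘
`controlGlobalPTorsionF_holds` p443572) applied to FILE 1 `unitRootCharacter`
(`…OrdinaryLineCharacter`).  A RECORD, off the leaf's critical path since p447721/p448348; closing it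
does not advance BSD.  Proof only; no definition, no named fact, no `sorry`.
-/

namespace Summit.BirchSwinnertonDyer.BirchSwinnertonDyer.Theorems.SchneiderFreeAdditiveX3

set_option linter.dupNamespace false

/-- **Item stmt-BirchSwinnertonDyer-19669 `AnticycControlAdditiveKFF`, proved**: the exact
anticyclotomic control count of the door's control corner under the cite-only norm-residue-symbol
fact, by `anticycControlAdditiveKFF_of_unitRoot unitRootCharacter`.
[cite: JetchevSkinnerWan2017, §3.3 Prop. 3.3.1, Thm. 3.3.3 (arXiv:1512.06894)] [cite: GreenbergLNM1716, §3 Lemma 3.3; §2 p. 70] -/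
theorem anticycControlAdditiveKFF_proof :
    Summit.BirchSwinnertonDyer.BirchSwinnertonDyer.Theses.SchneiderFreeAdditiveX3.AnticycControlAdditiveKFF :=
  anticycControlAdditiveKFF_of_unitRoot unitRootCharacter

end Summit.BirchSwinnertonDyer.BirchSwinnertonDyer.Theorems.SchneiderFreeAdditiveX3
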